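import Literature.MathematicalPhysics.QuantumFieldTheory.Balaban1983to89.B12Membership313II
import Literature.MathematicalPhysics.QuantumFieldTheory.Balaban1983to89.BlockAveragingFederbushGValued

/-!
# Bałaban, *Renormalization group approach to lattice gauge field theories. I* (CMP 109, 1987) [B12] — the sentence
# before (3.14), condition (ii) (1.13): the clause «A′ has values in the algebra 𝐠ᶜ» for the new potential
# `A″ = (iξ)⁻¹ log(e^{iξ𝐀} e^{iξA′})` of the product configuration `exp iξ𝐀·𝐔` — KERNEL-CHECKED

Companion to `B12Membership313II` (which transcribes the ANALYTIC half of (ii) for `exp iξ𝐀·𝐔`: the representation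
`e^{iξA″} = e^{iξ𝐀}e^{iξA′}`, `|A″| < α₁`, `|∇^ξ_U A″| < α₁`, and records in its reading note (a) that the clause «A′ has
values in the algebra 𝐠ᶜ» of (1.13) is NOT transcribed there).  This file types that one remaining clause.

THE PRINT.  B12 p. 262 [PDF 14], (1.13): *«(ii) U′ = exp iξA′, A′ has values in the algebra 𝐠ᶜ, |A′|, |∇^ξ_U A′| < α₁ on
X.»*; p. 272 [PDF 24] (the two sentences before (3.14)), verbatim: *«These restrictions can be easily
obtained from the definition of the spaces, and from the form of the expressions in (3.13). Thus, there exists a constant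
α₂, depending on α₀ and on some absolute constants, such that the function (3.13) is analytic in 𝐀, for 𝐀 satisfying the
conditions |𝐀|, |P₁𝐀|, |∇^ξ_𝐔𝐀|, |Δ^ξ_𝐔𝐀| < α₂ on X. (3.14)»* (the full passage from (3.13) on is quoted in the companion
`B12Membership313II`, header); p. 252 [PDF 4]: *«Therefore we also consider
the complexified group Gᶜ. Elements of this group are defined as matrices of the form 𝐔 = U′U, where U ∈ G and
U′ = exp iA′, A′ ∈ 𝐠ᶜ, 𝐠ᶜ is the complexification of the real Lie algebra 𝐠.»*  NOTATION: print sets the Lie algebras in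
bold (`𝐠`, `𝐠ᶜ`); inside «…» this file follows print, outside quotations it writes `𝔤ᶜ` for the model `Gc.lie` below.
v1.1 (DOCFIX, docstrings only, code byte-identical to v1): the v1 header and the docstring of `condII_expMul_lie` carried,
inside guillemets and attributed to p. 272, a sentence that is NOT the printed text of B12 p. 272 (cross-read finding M1; it
named "γ_2", a configuration "exp iL^{−j}η𝓙·𝐉" and "the spaces (1.11)-(1.15)", none of which occur there) — replaced by the
verbatim sentences above; no statement depended on it (the [cite] loci were and are p. 272 before (3.14), (1.13) p. 262,
p. 252).  Also D2/I1: `𝐠ᶜ` inside quotations, the gloss `= 𝔰𝔩(N, ℂ)` moved outside the guillemets.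

THE MODEL OF `Gᶜ`, `𝔤ᶜ` is the tree's (module `BlockAveragingFederbushGValued`, §1–§2): a LOG-CHARTED CLOSED SUBGROUP
`Gc : LogChart 𝔸` — carrier `Gc.carrier ∋ 1` closed under products, a real subspace `Gc.lie` with `exp Gc.lie ⊆ Gc.carrier`
and `log g ∈ Gc.lie` for `g ∈ Gc.carrier`, `‖g − 1‖ ≤ Gc.ρ` (`log` = the series `MatrixLog.mlog`); instances constructed there:
`specialLinearLogChart n` (`Gᶜ = SL(N, ℂ) = SU(N)ᶜ`, `𝔤ᶜ = 𝔰𝔩(N, ℂ) = ker tr`, `ρ = min(1/3, 3/N)`) and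
`complexOrthogonalLogChart n` (`O(N, ℂ) ⊇ SO(N)ᶜ`, `𝔤ᶜ = {Aᵀ = −A}`, `ρ = 1/3`).  Print's `𝔤ᶜ` is COMPLEX («the
complexification of the real Lie algebra»), which is the hypothesis `hI : X ∈ Gc.lie → i•X ∈ Gc.lie` below (verified for both
instances).

WHAT IS PROVED (Banach-algebra bookkeeping; the Lie-theoretic content is entirely the chart's `mlog_mem`, i.e. for `SL(N, ℂ)`
Liouville's `det e^A = e^{tr A}` and `tr log W = 0` for `det W = 1` near `1`, both already kernel-checked in the tree):
* §1 `bchLog X Y = MatrixLog.mlog (exp X * exp Y)` (`rfl`: the two tree series coincide), hence for `X, Y ∈ Gc.lie` with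
  `‖e^X e^Y − 1‖ ≤ Gc.ρ`: `e^X e^Y ∈ Gc.carrier` and `bchLog X Y ∈ Gc.lie` (`bchLog_mem_lie`); a real subspace closed under `i•`
  is closed under complex scalars (`smul_mem_lie_of_I_smul_mem`); so `newPot ξ 𝐀 A′ = (iξ)⁻¹ bchLog (iξ𝐀) (iξA′) ∈ Gc.lie`
  (`newPot_mem_lie`), quantitatively whenever `ξ(‖𝐀‖ + ‖A′‖) ≤ 1` and `2ξ(‖𝐀‖ + ‖A′‖) ≤ Gc.ρ` (`newPot_mem_lie_of_norm`, via
  `‖e^X e^Y − 1‖ ≤ 2(‖X‖ + ‖Y‖)` for `‖X‖ + ‖Y‖ ≤ 1`).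
* §2 THE TRANSCRIPTION `condII_expMul_lie` [cite: Balaban1987RG1]: under the hypotheses of `B12Membership313II.condII_expMul`
  (restriction `8α₂ ≤ α₁ ≤ 1/16`, `0 < ξ ≤ 1`) PLUS `𝐀(b), 𝐀(b₁), A′(b), A′(b₁) ∈ 𝔤ᶜ` and the chart-radius restriction
  `2α₁ ≤ Gc.ρ`, the full condition (ii) of (1.13) holds for the `U′`-factor `e^{iξA″}` of `exp iξ𝐀·𝐔` at the bond `b`:
  the four conclusions of `condII_expMul` AND `A″(b), A″(b₁) ∈ 𝔤ᶜ`.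
* §3 INSTANCES (matrices with the `L²`-operator norm): `SU(N)ᶜ`: `tr 𝐀 = tr A′ = 0 ⟹ tr A″ = 0` (`trace_newPot_eq_zero`,
  and under the transcription's hypotheses at one bond `trace_newPot_eq_zero_of_condII` [cite]); `SO(N)ᶜ ⊆ O(N, ℂ)`:
  `𝐀ᵀ = −𝐀, A′ᵀ = −A′ ⟹ A″ᵀ = −A″` (`transpose_newPot_eq_neg`); for `G = U(N)`, `𝔤ᶜ = M_N(ℂ)` and the clause is vacuous.

READING NOTES (recorded, nothing asserted).  (a) The restriction `2α₁ ≤ Gc.ρ` ties `α₁` to the radius on which the tree's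
chart certifies `log Gᶜ ⊆ 𝔤ᶜ`; for `SL(N, ℂ)` the tree's radius is `min(1/3, 3/N)` (its `tr log`-argument needs `N‖W − 1‖ < π`),
so in that model `α₁ ≤ min(1/6, 3/(2N))` — an `N`-dependence of the MODEL's constant, harmless for print (whose constants may
depend on `G`) and not a claim about the optimal radius.  (b) As in the companion file, `|·|` is any complete
submultiplicative algebra norm in §1–§2; §3 fixes the operator norm.  (c) Nothing here bears on Theorem 2 of [B12] or on any
disputed step; the file closes the bookkeeping of ONE clause of ONE membership sentence.
-/

noncomputable section

namespace Literature.MathematicalPhysics.QuantumFieldTheory.Balaban1983to89.B12Membership313IILie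

open NormedSpace
open Literature.MathematicalPhysics.QuantumFieldTheory.Balaban1983to89
open Literature.MathematicalPhysics.QuantumFieldTheory.Balaban1983to89.B12Membership314 (norm_I_mul_smul)
open Literature.MathematicalPhysics.QuantumFieldTheory.Balaban1983to89.B12Membership313II
open Complex (I)

section Abstract

variable {𝔸 : Type*} [NormedRing 𝔸] [NormedAlgebra ℂ 𝔸] [CompleteSpace 𝔸]

/-! ## §1  `log(e^X e^Y)` lies in the Lie algebra of a log-charted group -/

omit [CompleteSpace 𝔸] in
/-- The companion file's `bchLog X Y = log(1 + (e^X e^Y − 1))` IS the tree's matrix logarithm `MatrixLog.mlog (e^X e^Y)`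
(both are the series `∑ (−1)^{n+1} wⁿ/n`, `w = e^X e^Y − 1`). [folklore] -/
theorem bchLog_eq_mlog (X Y : 𝔸) : bchLog X Y = MatrixLog.mlog (exp X * exp Y) := rfl

omit [CompleteSpace 𝔸] in
/-- A real subspace of a complex algebra that is closed under multiplication by `i` is closed under all complex scalars
(`c•X = (Re c)•X + (Im c)•(i•X)`) — print's `𝔤ᶜ` is «the complexification of the real Lie algebra 𝐠» (p. 252). [folklore] -/
theorem smul_mem_lie_of_I_smul_mem (Gc : LogChart 𝔸) (hI : ∀ ⦃X : 𝔸⦄, X ∈ Gc.lie → (I : ℂ) • X ∈ Gc.lie)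
    (c : ℂ) {X : 𝔸} (hX : X ∈ Gc.lie) : c • X ∈ Gc.lie := by
  have h : c • X = c.re • X + c.im • ((I : ℂ) • X) := by
    calc c • X = ((c.re : ℂ) + (c.im : ℂ) * I) • X := by rw [Complex.re_add_im]
      _ = (c.re : ℂ) • X + (c.im : ℂ) • ((I : ℂ) • X) := by rw [add_smul, mul_smul]
      _ = c.re • X + c.im • ((I : ℂ) • X) := by rw [Complex.coe_smul, Complex.coe_smul]
  rw [h]
  exact Gc.lie.add_mem (Gc.lie.smul_mem _ hX) (Gc.lie.smul_mem _ (hI hX))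

omit [CompleteSpace 𝔸] in
/-- `X, Y ∈ 𝔤ᶜ ⟹ e^X e^Y ∈ Gᶜ` (chart axioms `exp_mem`, `mul_mem`). [folklore] -/
theorem exp_mul_exp_mem (Gc : LogChart 𝔸) {X Y : 𝔸} (hX : X ∈ Gc.lie) (hY : Y ∈ Gc.lie) :
    exp X * exp Y ∈ Gc.carrier :=
  Gc.mul_mem (Gc.exp_mem hX) (Gc.exp_mem hY)

omit [CompleteSpace 𝔸] in
/-- **`log(e^X e^Y) ∈ 𝔤ᶜ`** for `X, Y ∈ 𝔤ᶜ` with `e^X e^Y` inside the chart radius: `‖e^X e^Y − 1‖ ≤ ρ` (chart axiom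
`mlog_mem`). This is the Lie-theoretic content of the Baker–Campbell–Hausdorff series, carried by the chart. [folklore] -/
theorem bchLog_mem_lie (Gc : LogChart 𝔸) {X Y : 𝔸} (hX : X ∈ Gc.lie) (hY : Y ∈ Gc.lie)
    (hρ : ‖exp X * exp Y - 1‖ ≤ Gc.ρ) : bchLog X Y ∈ Gc.lie := by
  rw [bchLog_eq_mlog]
  exact Gc.mlog_mem (exp_mul_exp_mem Gc hX hY) hρ

/-- `‖e^X e^Y − 1‖ ≤ 2(‖X‖ + ‖Y‖)` for `‖X‖ + ‖Y‖ ≤ 1` (from `‖e^X e^Y − 1‖ ≤ e^{‖X‖+‖Y‖} − 1` and `e^s − 1 ≤ 2s` on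
`[0, 1]`). [folklore] -/
theorem norm_expMul_sub_one_le_two_mul {X Y : 𝔸} (h : ‖X‖ + ‖Y‖ ≤ 1) :
    ‖exp X * exp Y - 1‖ ≤ 2 * (‖X‖ + ‖Y‖) := by
  have h0 : 0 ≤ ‖X‖ + ‖Y‖ := add_nonneg (norm_nonneg _) (norm_nonneg _)
  have h1 : ‖exp X * exp Y - 1‖ ≤ Real.exp (‖X‖ + ‖Y‖) - 1 := norm_exp_mul_exp_sub_one_le_of_le le_rfl
  have h2 : |Real.exp (‖X‖ + ‖Y‖) - 1| ≤ 2 * |‖X‖ + ‖Y‖| :=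
    Real.abs_exp_sub_one_le (by rwa [abs_of_nonneg h0])
  rw [abs_of_nonneg h0] at h2
  exact h1.trans ((le_abs_self _).trans h2)

omit [CompleteSpace 𝔸] in
/-- **`A″ = newPot ξ 𝐀 A′ ∈ 𝔤ᶜ`** for `𝐀, A′ ∈ 𝔤ᶜ` (complex `𝔤ᶜ`) with `e^{iξ𝐀}e^{iξA′}` inside the chart radius.
[folklore] -/
theorem newPot_mem_lie (Gc : LogChart 𝔸) (hI : ∀ ⦃X : 𝔸⦄, X ∈ Gc.lie → (I : ℂ) • X ∈ Gc.lie) {ξ : ℝ} {A A' : 𝔸}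
    (hA : A ∈ Gc.lie) (hA' : A' ∈ Gc.lie) (hρ : ‖exp ((I * ξ) • A) * exp ((I * ξ) • A') - 1‖ ≤ Gc.ρ) :
    newPot ξ A A' ∈ Gc.lie := by
  unfold newPot
  exact smul_mem_lie_of_I_smul_mem Gc hI _ (bchLog_mem_lie Gc (smul_mem_lie_of_I_smul_mem Gc hI _ hA)
    (smul_mem_lie_of_I_smul_mem Gc hI _ hA') hρ)

/-- **`A″ ∈ 𝔤ᶜ`, quantitative form**: `𝐀, A′ ∈ 𝔤ᶜ`, `0 ≤ ξ`, `ξ(‖𝐀‖ + ‖A′‖) ≤ 1` and `2ξ(‖𝐀‖ + ‖A′‖) ≤ ρ` give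
`newPot ξ 𝐀 A′ ∈ 𝔤ᶜ`. [folklore] -/
theorem newPot_mem_lie_of_norm (Gc : LogChart 𝔸) (hI : ∀ ⦃X : 𝔸⦄, X ∈ Gc.lie → (I : ℂ) • X ∈ Gc.lie) {ξ : ℝ}
    (hξ : 0 ≤ ξ) {A A' : 𝔸} (hA : A ∈ Gc.lie) (hA' : A' ∈ Gc.lie) (h1 : ξ * (‖A‖ + ‖A'‖) ≤ 1)
    (h2 : 2 * (ξ * (‖A‖ + ‖A'‖)) ≤ Gc.ρ) : newPot ξ A A' ∈ Gc.lie := by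
  have e : ‖(I * ξ) • A‖ + ‖(I * ξ) • A'‖ = ξ * (‖A‖ + ‖A'‖) := by
    rw [norm_I_mul_smul hξ, norm_I_mul_smul hξ]; ring
  refine newPot_mem_lie Gc hI hA hA' ?_
  calc ‖exp ((I * ξ) • A) * exp ((I * ξ) • A') - 1‖ ≤ 2 * (‖(I * ξ) • A‖ + ‖(I * ξ) • A'‖) :=
        norm_expMul_sub_one_le_two_mul (by rw [e]; exact h1)
    _ = 2 * (ξ * (‖A‖ + ‖A'‖)) := by rw [e]
    _ ≤ Gc.ρ := h2

/-! ## §2  B12 p. 272 → condition (ii) of (1.13) for `exp iξ𝐀·𝐔`, WITH the clause «values in the algebra 𝐠ᶜ» -/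

/-- **[B12 p. 272, sentence before (3.14)] — condition (ii) of (1.13) IN FULL for the `U′`-factor of `exp iξ𝐀·𝐔` at one
bond `b` and its `ν`-neighbour `b₁`.**  Print, p. 262: *«(ii) U′ = exp iξA′, A′ has values in the algebra 𝐠ᶜ, |A′|,
|∇^ξ_U A′| < α₁ on X. (1.13)»*; p. 272: *«Thus, there exists a constant α₂, depending on α₀ and on some absolute constants,
such that the function (3.13) is analytic in 𝐀, for 𝐀 satisfying the conditions |𝐀|, |P₁𝐀|, |∇^ξ_𝐔𝐀|, |Δ^ξ_𝐔𝐀| < α₂ on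
X. (3.14)»*.  Hypotheses: those of the companion
transcription `B12Membership313II.condII_expMul` ((1.13) with `½α₁` for `A′` at `b`, `b₁` and for `A′_ν(x) = B′`; (3.14)
with `α₂` for `𝐀`; `0 < ξ ≤ 1`; ONE admissible restriction `8α₂ ≤ α₁ ≤ 1/16`), PLUS: `Gᶜ` is a log-charted group
`Gc` with complex Lie algebra (`hI`), `𝐀(b), 𝐀(b₁), A′(b), A′(b₁) ∈ 𝔤ᶜ`, and the chart-radius restriction `2α₁ ≤ Gc.ρ`.
Conclusion: with `A″ := newPot ξ 𝐀 A′ = (iξ)⁻¹log(e^{iξ𝐀}e^{iξA′})` — `e^{iξA″} = e^{iξ𝐀}e^{iξA′}` at `b` and `b₁`,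
`|A″(b)| < α₁`, `|∇^ξ_{U,ν}A″(b)| < α₁`, AND `A″(b), A″(b₁) ∈ 𝔤ᶜ`: all of (ii) (1.13) with `α₁` at `b`.
[cite: Balaban1987RG1, p. 272 (sentence before (3.14)) with (1.13) p. 262 and p. 252 («𝐠ᶜ is the complexification of the
real Lie algebra 𝐠») — condition (ii) including the clause «A′ has values in the algebra 𝐠ᶜ»; the proof, the admissible
restriction and the model of `Gᶜ` (the tree's `LogChart`) are ours, the print gives none] -/
theorem condII_expMul_lie (Gc : LogChart 𝔸) (hI : ∀ ⦃X : 𝔸⦄, X ∈ Gc.lie → (I : ℂ) • X ∈ Gc.lie)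
    {ξ α₁ α₂ : ℝ} (hξ : 0 < ξ) (hξ1 : ξ ≤ 1) (hres : 8 * α₂ ≤ α₁) (hα₁ : 16 * α₁ ≤ 1) (hρ : 2 * α₁ ≤ Gc.ρ)
    (u : 𝔸ˣ) (B' A A₁ A' A'₁ : 𝔸)
    (hAl : A ∈ Gc.lie) (hA₁l : A₁ ∈ Gc.lie) (hA'l : A' ∈ Gc.lie) (hA'₁l : A'₁ ∈ Gc.lie)
    (hA' : ‖A'‖ < 1 / 2 * α₁) (hA'₁ : ‖A'₁‖ < 1 / 2 * α₁) (hB' : ‖B'‖ < 1 / 2 * α₁)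
    (hDA' : ‖(ξ : ℂ)⁻¹ • ((u : 𝔸) * A'₁ * ↑u⁻¹ - A')‖ < 1 / 2 * α₁)
    (hA : ‖A‖ < α₂) (hA₁ : ‖A₁‖ < α₂)
    (hDA : ‖(ξ : ℂ)⁻¹ • ((↑(Beta.BackgroundVertices.expUnit ℂ ((I * ξ) • B') * u) : 𝔸) * A₁ *
        ↑(Beta.BackgroundVertices.expUnit ℂ ((I * ξ) • B') * u)⁻¹ - A)‖ < α₂) :
    (exp ((I * ξ) • newPot ξ A A') = exp ((I * ξ) • A) * exp ((I * ξ) • A') ∧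
      exp ((I * ξ) • newPot ξ A₁ A'₁) = exp ((I * ξ) • A₁) * exp ((I * ξ) • A'₁) ∧
      ‖newPot ξ A A'‖ < α₁ ∧
      ‖(ξ : ℂ)⁻¹ • ((u : 𝔸) * newPot ξ A₁ A'₁ * ↑u⁻¹ - newPot ξ A A')‖ < α₁) ∧
    newPot ξ A A' ∈ Gc.lie ∧ newPot ξ A₁ A'₁ ∈ Gc.lie := by
  have nA0 := norm_nonneg A
  have nA'0 := norm_nonneg A'
  have nA₁0 := norm_nonneg A₁
  have nA'₁0 := norm_nonneg A'₁
  -- size budget for the chart: `ξ(‖𝐀‖ + ‖A′‖) ≤ ‖𝐀‖ + ‖A′‖ < α₂ + ½α₁ ≤ ⅝α₁ ≤ 5/128`, `2·⅝α₁ ≤ 2α₁ ≤ ρ`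
  have hs : ξ * (‖A‖ + ‖A'‖) ≤ ‖A‖ + ‖A'‖ := mul_le_of_le_one_left (add_nonneg nA0 nA'0) hξ1
  have hs₁ : ξ * (‖A₁‖ + ‖A'₁‖) ≤ ‖A₁‖ + ‖A'₁‖ := mul_le_of_le_one_left (add_nonneg nA₁0 nA'₁0) hξ1
  refine ⟨condII_expMul hξ hξ1 hres hα₁ u B' A A₁ A' A'₁ hA' hA'₁ hB' hDA' hA hA₁ hDA, ?_, ?_⟩
  · exact newPot_mem_lie_of_norm Gc hI hξ.le hAl hA'l (by linarith) (by linarith)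
  · exact newPot_mem_lie_of_norm Gc hI hξ.le hA₁l hA'₁l (by linarith) (by linarith)

end Abstract

/-! ## §3  Instances: `SU(N)ᶜ = SL(N, ℂ)` (trace-free potentials) and `SO(N)ᶜ ⊆ O(N, ℂ)` (antisymmetric potentials) -/

section Instances

open scoped Matrix.Norms.L2Operator

variable {n : Type*} [Fintype n] [DecidableEq n]

/-- `𝔰𝔩(N, ℂ) = ker tr` is a complex subspace: closed under `i•`. [folklore] -/
theorem I_smul_mem_specialLinearLogChart_lie [Nonempty n] ⦃X : Matrix n n ℂ⦄
    (hX : X ∈ (specialLinearLogChart n).lie) : (I : ℂ) • X ∈ (specialLinearLogChart n).lie := by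
  rw [mem_specialLinearLogChart_lie] at hX ⊢
  rw [Matrix.trace_smul, hX, smul_zero]

/-- `𝔬(N, ℂ) = {Aᵀ = −A}` is a complex subspace: closed under `i•`. [folklore] -/
theorem I_smul_mem_complexOrthogonalLogChart_lie ⦃X : Matrix n n ℂ⦄
    (hX : X ∈ (complexOrthogonalLogChart n).lie) : (I : ℂ) • X ∈ (complexOrthogonalLogChart n).lie := by
  rw [mem_complexOrthogonalLogChart_lie] at hX ⊢
  rw [Matrix.transpose_smul, hX, smul_neg]

/-- **`G = SU(N)`, `Gᶜ = SL(N, ℂ)`, `𝔤ᶜ = 𝔰𝔩(N, ℂ)`**: trace-free `𝐀`, `A′` with `ξ(‖𝐀‖ + ‖A′‖) ≤ 1` and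
`2ξ(‖𝐀‖ + ‖A′‖) ≤ min(1/3, 3/N)` (the tree's chart radius for `SL(N, ℂ)`) give a trace-free `A″ = newPot ξ 𝐀 A′`
(operator norm). [folklore] -/
theorem trace_newPot_eq_zero [Nonempty n] {ξ : ℝ} (hξ : 0 ≤ ξ) {A A' : Matrix n n ℂ} (hA : A.trace = 0)
    (hA' : A'.trace = 0) (h1 : ξ * (‖A‖ + ‖A'‖) ≤ 1)
    (h2 : 2 * (ξ * (‖A‖ + ‖A'‖)) ≤ min (1 / 3) (3 / (Fintype.card n : ℝ))) :
    (newPot ξ A A').trace = 0 :=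
  (mem_specialLinearLogChart_lie).1
    (newPot_mem_lie_of_norm (specialLinearLogChart n) I_smul_mem_specialLinearLogChart_lie hξ
      ((mem_specialLinearLogChart_lie).2 hA) ((mem_specialLinearLogChart_lie).2 hA') h1
      (by rw [specialLinearLogChart_ρ]; exact h2))

/-- **`G = SO(N)`, `SO(N)ᶜ ⊆ O(N, ℂ)`, `𝔤ᶜ = 𝔰𝔬(N, ℂ) = {Aᵀ = −A}`**: antisymmetric `𝐀`, `A′` with `ξ(‖𝐀‖ + ‖A′‖) ≤ 1`
and `2ξ(‖𝐀‖ + ‖A′‖) ≤ 1/3` give an antisymmetric `A″ = newPot ξ 𝐀 A′` (operator norm). [folklore] -/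
theorem transpose_newPot_eq_neg {ξ : ℝ} (hξ : 0 ≤ ξ) {A A' : Matrix n n ℂ} (hA : A.transpose = -A)
    (hA' : A'.transpose = -A') (h1 : ξ * (‖A‖ + ‖A'‖) ≤ 1) (h2 : 2 * (ξ * (‖A‖ + ‖A'‖)) ≤ 1 / 3) :
    (newPot ξ A A').transpose = -newPot ξ A A' :=
  (mem_complexOrthogonalLogChart_lie).1
    (newPot_mem_lie_of_norm (complexOrthogonalLogChart n) I_smul_mem_complexOrthogonalLogChart_lie hξ
      ((mem_complexOrthogonalLogChart_lie).2 hA) ((mem_complexOrthogonalLogChart_lie).2 hA') h1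
      (by rw [complexOrthogonalLogChart_ρ]; exact h2))

/-- **(ii) of (1.13) for `G = SU(N)` — the clause «A′ has values in the algebra 𝐠ᶜ», here `𝔤ᶜ = 𝔰𝔩(N, ℂ)`** (operator
norm) under the companion
transcription's hypotheses at one bond: `0 < ξ ≤ 1`, `8α₂ ≤ α₁ ≤ 1/16`, `|A′(b)| < ½α₁`, `|𝐀(b)| < α₂`, trace-free `𝐀(b)`,
`A′(b)`, and the chart-radius restriction `2α₁ ≤ min(1/3, 3/N)`: then `tr A″(b) = 0`.  (The four analytic conclusions are
`B12Membership313II.condII_expMul` specialised to matrices; apply the present theorem at `b` and at `b₁`.)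
[cite: Balaban1987RG1, p. 272 (sentence before (3.14)) with (1.13) p. 262 — the clause «A′ has values in the algebra 𝐠ᶜ» of
condition (ii) for `G = SU(N)`; proof, restriction and model of `𝔤ᶜ` ours] -/
theorem trace_newPot_eq_zero_of_condII [Nonempty n] {ξ α₁ α₂ : ℝ} (hξ : 0 < ξ) (hξ1 : ξ ≤ 1) (hres : 8 * α₂ ≤ α₁)
    (hα₁ : 16 * α₁ ≤ 1) (hρ : 2 * α₁ ≤ min (1 / 3) (3 / (Fintype.card n : ℝ))) {A A' : Matrix n n ℂ}
    (hAl : A.trace = 0) (hA'l : A'.trace = 0) (hA' : ‖A'‖ < 1 / 2 * α₁) (hA : ‖A‖ < α₂) :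
    (newPot ξ A A').trace = 0 := by
  have nA0 := norm_nonneg A
  have nA'0 := norm_nonneg A'
  have hs : ξ * (‖A‖ + ‖A'‖) ≤ ‖A‖ + ‖A'‖ := mul_le_of_le_one_left (add_nonneg nA0 nA'0) hξ1
  exact trace_newPot_eq_zero hξ.le hAl hA'l (by linarith) (by linarith)

end Instances

end Literature.MathematicalPhysics.QuantumFieldTheory.Balaban1983to89.B12Membership313IILie
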